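import Literature.GroupTheory.CombinatorialGroupTheory.QuadraticWordsCollapse
import Literature.GroupTheory.CombinatorialGroupTheory.NielsenGeneratingTuplesNormalForm
import HarnessLib

/-!
# Zieschang's reduction of an alternating product with trivial value

Topic `Literature/GroupTheory/CombinatorialGroupTheory`.  The Nielsen–Zieschang cancellation
argument for alternating quadratic words (H. Zieschang, *Alternierende Produkte in freien
Gruppen* (1964); Zieschang–Vogt–Coldewey, LNM 835 (1980), §5.2: Thm. 5.2.6 *"For each binary
product there is a related binary product with the [Nielsen] properties"* and the first step of
the proof of Thm. 5.2.8; exercise E 5.4), made effective for a product with VALUE `1`.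

A *state* is an alternating quadratic word `w` over the symbols `ι` (`QuadraticWords.lean`)
together with an assignment `X : ι → F` of its symbols in a free group `F = F(Fin n)` killing
it, `X̂(w) = 1` (`X̂ = FreeGroup.lift X`); its *trivial symbols* are `Z = {i | X i = 1}`.  The
state is **terminal** if `w` dies when the trivial symbols are deleted (`killHom Z w = 1`: every
symbol with a nontrivial value is inessential).  **Engine** (`exists_terminal`): every state is
carried by finitely many transport moves (bifurcations) to a terminal one — precisely, there are
a word `w'`, a permutation of `w`, and an automorphism `θ` of `F(ι)` with `θ(w')` conjugate to
`w` such that the transformed assignment `X' = X̂ ∘ θ` (which kills `w'`) is terminal on `w'`.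

The step (`exists_step`): delete the trivial symbols from `w` and freely reduce, keeping track of
where the surviving letters sit in `w` (`exists_reduce_filter_decomp`); the values of the
survivors are nontrivial and multiply, in order, to `X̂(w) = 1`, because the deleted material
between two consecutive survivors has trivial value.  If the state is not terminal there is a
survivor, so by the local length argument (`exists_violation_of_prod_eq_one`) the Nielsen
property fails at two or three CONSECUTIVE survivors `x, y (, z)`.  If more than half of the
value `v` of `y` cancels into the value `u` of `x`, transport `y` together with the gap before it
onto `x` (`exists_move_absorb_right`: the value of the symbol of `x` becomes `uv`, shorter than
`u`); symmetrically (`exists_move_absorb_left`); if exactly the two halves of `v` cancel into its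
neighbours, one of the same two moves keeps the total length and lowers Lyndon–Schupp's
left-half weight (`norm_mul_eq_and_lexWeight_lt_or`).  The measure
`(Σᵢ ‖X i‖, Σᵢ lexWeight (X i))` decreases lexicographically, so the process stops.

## References

* H. Zieschang, *Alternierende Produkte in freien Gruppen*, Abh. Math. Sem. Univ. Hamburg 27
  (1964) 13–31. [Zieschang1964]
* H. Zieschang, E. Vogt, H.-D. Coldewey, *Surfaces and Planar Discontinuous Groups*, LNM 835
  (1980), §5.2: 5.2.4, Thm. 5.2.6, proof of Thm. 5.2.8, E 5.4. [ZieschangVogtColdewey1980]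
* R. C. Lyndon, P. E. Schupp, *Combinatorial Group Theory* (2001), Ch. I §2 (proof of Prop. 2.2).
  [LyndonSchupp2001]
-/

namespace Literature.GroupTheory.CombinatorialGroupTheory

open List

variable {ι : Type*} [DecidableEq ι]

/-! ### Values of letters -/

section Values

variable {G : Type*} [Group G] (X : ι → G)

omit [DecidableEq ι] in
/-- The value of a word is the product of the values of its blocks `x :: g`. [folklore] -/
theorem lift_mk_flatten_blocks (blocks : List ((ι × Bool) × List (ι × Bool))) :
    FreeGroup.lift X (FreeGroup.mk (blocks.map fun b => b.1 :: b.2).flatten) =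
      (blocks.map fun b => FreeGroup.lift X (sgen b.1.1 b.1.2) * FreeGroup.lift X (FreeGroup.mk b.2)).prod := by
  induction blocks with
  | nil => exact map_one _
  | cons b blocks ih =>
    rw [map_cons, flatten_cons, mk_append, map_mul, ih, mk_cons_eq_sgen_mul, map_mul, map_cons,
      prod_cons]

omit [DecidableEq ι] in
/-- A word killed by deleting the letters whose symbols have trivial value has trivial value.
[folklore] -/
theorem lift_mk_eq_one_of_filter [DecidableEq G] {L : List (ι × Bool)}
    (h : FreeGroup.mk (L.filter fun x => decide ¬ (X x.1 = 1)) = 1) :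
    FreeGroup.lift X (FreeGroup.mk L) = 1 := by
  classical
  rw [← lift_killHom (fun i => X i = 1) X (fun i hi => hi), killHom_mk, h, map_one]

end Values

/-! ### The partner of a survivor is not hidden in a gap -/

/-- In a quadratic word `w = E ++ x :: F`, a segment `g` of `E` or of `F` which becomes trivial
after deleting letters by a rule keeping both `x` and its partner cannot contain the partner of
`x` (else, being balanced, it would contain a second copy of `x`). [folklore] -/
theorem IsQuadratic.partner_not_mem_of_gap {w : List (ι × Bool)} (hq : IsQuadratic w) {x : ι × Bool}
    {E F g : List (ι × Bool)} (hw : w = E ++ x :: F) (hgs : g <+ E ∨ g <+ F) (q : ι × Bool → Bool)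
    (hqx : q x = true) (hqx' : q (x.1, !x.2) = true) (hg : FreeGroup.mk (g.filter q) = 1) :
    (x.1, !x.2) ∉ g := by
  obtain ⟨i, b⟩ := x
  intro hmem
  have hbal := count_true_eq_count_false_of_mk_eq_one hg i
  -- the partner is in `g.filter q`, hence so is `x`
  have hp : (i, !b) ∈ g.filter q := mem_filter.2 ⟨hmem, hqx'⟩
  have hxg : (i, b) ∈ g.filter q := by
    rw [← count_pos_iff] at hp ⊢
    cases b
    · simp only [Bool.not_false] at hp; omega
    · simp only [Bool.not_true] at hp; omega
  have hxg' : (i, b) ∈ g := (mem_filter.1 hxg).1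
  -- so `x` occurs twice in `w`
  have h2 : 2 ≤ w.count (i, b) := by
    rw [hw, count_append, count_cons_self]
    rcases hgs with hs | hs
    · have := hs.count_le (i, b); have := count_pos_iff.2 hxg'; omega
    · have := hs.count_le (i, b); have := count_pos_iff.2 hxg'; omega
  have := hq.count_le_one (i, b)
  omega

/-! ### The two moves -/

section Moves

variable {G : Type*} [Group G]

/-- **Right absorption.**  In a quadratic word `w = E x g y R` (`x`, `y` letters, the partner of
`x` neither in `g` nor equal to `y`), transporting the segment `g y` onto `x` gives a permutation
`w'` of `w` and an automorphism `ψ` of `F(ι)` (the transvection `x ↦ x·g·y`) fixing the other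
generators, with `ψ(w')` conjugate to `w`; for an assignment `X` with `X̂(g) = 1` the new value of
the letter `x` is `X̂(x) X̂(y)`. [cite: ZieschangVogtColdewey1980, 5.2.2–5.2.4] -/
theorem exists_move_absorb_right {w : List (ι × Bool)} (hq : IsQuadratic w)
    {E g R : List (ι × Bool)} {x y : ι × Bool} (hw : w = E ++ x :: (g ++ y :: R))
    (hxg : (x.1, !x.2) ∉ g) (hxy : (x.1, !x.2) ≠ y) (X : ι → G)
    (hg : FreeGroup.lift X (FreeGroup.mk g) = 1) :
    ∃ (w' : List (ι × Bool)) (ψ : MulAut (FreeGroup ι)) (c : FreeGroup ι),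
      w' ~ w ∧ ψ (FreeGroup.mk w') = c * FreeGroup.mk w * c⁻¹ ∧
      (∀ i, i ≠ x.1 → ψ (FreeGroup.of i) = FreeGroup.of i) ∧
      FreeGroup.lift X (ψ (sgen x.1 x.2)) =
        FreeGroup.lift X (sgen x.1 x.2) * FreeGroup.lift X (sgen y.1 y.2) := by
  obtain ⟨k, s⟩ := x
  simp only at hxg hxy ⊢
  -- the rotation starting at `x`
  set w₁ := (k, s) :: (g ++ y :: R) ++ E with hw₁
  have hperm₁ : w₁ ~ w := by rw [hw, hw₁]; exact perm_append_comm
  have hq₁ : IsQuadratic w₁ := hq.perm hperm₁.symm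
  -- locate the partner: it lies in `R ++ E`
  have hpw : (k, !s) ∈ w₁ := hq₁.partner_mem (x := (k, s)) (by simp [hw₁])
  have hpRE : (k, !s) ∈ R ++ E := by
    simp only [hw₁, cons_append, mem_cons, append_assoc, mem_append] at hpw
    rcases hpw with h | h | h | h
    · have := (Prod.mk.inj h).2; cases s <;> simp at this
    · exact absurd h hxg
    · exact absurd h hxy
    · simpa [mem_append] using h
  obtain ⟨B, C, hBC⟩ := append_of_mem hpRE
  -- template form of `w₁`
  have hw₁' : w₁ = [] ++ (k, s) :: ((g ++ [y]) ++ B ++ (k, !s) :: C) := by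
    rw [hw₁]
    have : (k, s) :: (g ++ y :: R) ++ E = (k, s) :: ((g ++ [y]) ++ (R ++ E)) := by simp
    rw [this, hBC]; simp
  have hsplit : IsQuadratic ([] ++ (k, s) :: (((g ++ [y]) ++ B) ++ (k, !s) :: C)) := hw₁' ▸ hq₁
  obtain ⟨-, hWB, hC⟩ := hsplit.avoids_of_split
  rw [avoids_append] at hWB
  obtain ⟨hW, hB⟩ := hWB
  -- the move
  refine ⟨[] ++ (k, s) :: (B ++ (g ++ [y]) ++ (k, !s) :: C), transv k s (g ++ [y]) hW,
    (FreeGroup.mk E)⁻¹, ?_, ?_, fun i hi => transv_of_ne k s _ hW hi, ?_⟩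
  · refine ((perm_transport (k, s) (k, !s) [] (g ++ [y]) B C).trans ?_).trans hperm₁
    rw [hw₁']
  · rw [transv_mk_transport_left k s [] (g ++ [y]) B C (avoids_nil k) hW hB hC, ← hw₁', hw₁, hw]
    simp only [mk_append, mk_cons_eq_sgen_mul]
    group
  · rw [transv_sgen, map_mul, mk_append, map_mul, hg, one_mul, mk_cons_eq_sgen_mul, map_mul,
      show (FreeGroup.mk [] : FreeGroup ι) = 1 from rfl, map_one, mul_one]

/-- **Left absorption.**  In a quadratic word `w = E x g y R` (the partner of `y` neither in `g`
nor equal to `x`), transporting the segment `x g` onto `y` gives a permutation `w'` of `w` and an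
automorphism `ψ` (the transvection `ȳ ↦ ȳ · (x g)⁻¹`) fixing the other generators, with `ψ(w')`
conjugate to `w`; for `X` with `X̂(g) = 1` the new value of the letter `y` is `X̂(x) X̂(y)`.
[cite: ZieschangVogtColdewey1980, 5.2.2–5.2.4] -/
theorem exists_move_absorb_left {w : List (ι × Bool)} (hq : IsQuadratic w)
    {E g R : List (ι × Bool)} {x y : ι × Bool} (hw : w = E ++ x :: (g ++ y :: R))
    (hyg : (y.1, !y.2) ∉ g) (hyx : (y.1, !y.2) ≠ x) (X : ι → G)
    (hg : FreeGroup.lift X (FreeGroup.mk g) = 1) :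
    ∃ (w' : List (ι × Bool)) (ψ : MulAut (FreeGroup ι)) (c : FreeGroup ι),
      w' ~ w ∧ ψ (FreeGroup.mk w') = c * FreeGroup.mk w * c⁻¹ ∧
      (∀ i, i ≠ y.1 → ψ (FreeGroup.of i) = FreeGroup.of i) ∧
      FreeGroup.lift X (ψ (sgen y.1 y.2)) =
        FreeGroup.lift X (sgen x.1 x.2) * FreeGroup.lift X (sgen y.1 y.2) := by
  obtain ⟨k, t⟩ := y
  simp only at hyg hyx ⊢
  -- the rotation starting at `y`
  set w₁ := (k, t) :: R ++ E ++ x :: g with hw₁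
  have hperm₁ : w₁ ~ w := by
    rw [hw, hw₁]
    have : E ++ x :: (g ++ (k, t) :: R) = (E ++ x :: g) ++ ((k, t) :: R) := by simp
    rw [this, show (k, t) :: R ++ E ++ x :: g = ((k, t) :: R) ++ (E ++ x :: g) by simp]
    exact perm_append_comm
  have hq₁ : IsQuadratic w₁ := hq.perm hperm₁.symm
  -- locate the partner of `y`: it lies in `R ++ E`
  have hpw : (k, !t) ∈ w₁ := hq₁.partner_mem (x := (k, t)) (by simp [hw₁])
  have hpRE : (k, !t) ∈ R ++ E := by
    simp only [hw₁, cons_append, mem_cons, append_assoc, mem_append] at hpw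
    rcases hpw with h | h | h | h | h
    · have := (Prod.mk.inj h).2; cases t <;> simp at this
    · exact mem_append.2 (Or.inl h)
    · exact mem_append.2 (Or.inr h)
    · exact absurd h hyx
    · exact absurd h hyg
  obtain ⟨G', H, hGH⟩ := append_of_mem hpRE
  -- second rotation, starting at the partner `ȳ`
  set w₂ := (k, !t) :: (H ++ x :: g) ++ [(k, t)] ++ G' with hw₂
  have hw₁' : w₁ = ((k, t) :: G') ++ ((k, !t) :: (H ++ x :: g)) := by
    rw [hw₁]
    have : (k, t) :: R ++ E ++ x :: g = (k, t) :: ((R ++ E) ++ x :: g) := by simp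
    rw [this, hGH]; simp
  have hperm₂ : w₂ ~ w₁ := by
    rw [hw₁', hw₂]
    have : (k, !t) :: (H ++ x :: g) ++ [(k, t)] ++ G' = ((k, !t) :: (H ++ x :: g)) ++ ((k, t) :: G') := by
      simp
    rw [this]
    exact perm_append_comm
  have hq₂ : IsQuadratic w₂ := hq₁.perm hperm₂.symm
  -- template form of `w₂`: `ȳ · H · (x g) · y · G'`
  have hw₂' : w₂ = [] ++ (k, !t) :: (H ++ (x :: g) ++ (k, !!t) :: G') := by
    rw [hw₂, Bool.not_not]; simp
  have hsplit : IsQuadratic ([] ++ (k, !t) :: ((H ++ (x :: g)) ++ (k, !!t) :: G')) := by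
    simpa [hw₂'] using hq₂
  obtain ⟨-, hHB, hC⟩ := hsplit.avoids_of_split
  rw [avoids_append] at hHB
  obtain ⟨hH, hB⟩ := hHB
  -- the move: `y` absorbs `x g` from the left, realised by `ȳ ↦ ȳ (x g)⁻¹`
  refine ⟨[] ++ (k, !t) :: ((x :: g) ++ H ++ (k, !!t) :: G'), transv k (!t) (FreeGroup.invRev (x :: g)) hB.invRev,
    (FreeGroup.mk ((k, t) :: G'))⁻¹ * (FreeGroup.mk (E ++ x :: g))⁻¹, ?_, ?_,
    fun i hi => transv_of_ne k (!t) _ hB.invRev hi, ?_⟩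
  · refine ((perm_transport (k, !t) (k, !!t) [] H (x :: g) G').trans ?_).trans (hperm₂.trans hperm₁)
    rw [hw₂']
  · rw [transv_mk_transport_right k (!t) [] H (x :: g) G' (avoids_nil k) hH hB hC, ← hw₂']
    -- `mk w₂` is conjugate to `mk w₁`, which is conjugate to `mk w`
    have e₂ : FreeGroup.mk w₂ = (FreeGroup.mk ((k, t) :: G'))⁻¹ * FreeGroup.mk w₁ * FreeGroup.mk ((k, t) :: G') := by
      rw [hw₁', hw₂]
      simp only [mk_append, mk_cons_eq_sgen_mul, show (FreeGroup.mk [] : FreeGroup ι) = 1 from rfl, mul_one]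
      group
    have e₁ : FreeGroup.mk w₁ = (FreeGroup.mk (E ++ x :: g))⁻¹ * FreeGroup.mk w * FreeGroup.mk (E ++ x :: g) := by
      rw [hw₁, hw]
      simp only [mk_append, mk_cons_eq_sgen_mul]
      group
    rw [e₂, e₁]
    group
  · -- the new value of `y`
    have hval : transv k (!t) (FreeGroup.invRev (x :: g)) hB.invRev (sgen k t) =
        FreeGroup.mk (x :: g) * sgen k t := by
      have h := transv_sgen k (!t) (FreeGroup.invRev (x :: g)) hB.invRev
      rw [sgen_not, map_inv, ← FreeGroup.inv_mk, ← mul_inv_rev, inv_inj] at h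
      exact h
    rw [hval, map_mul, mk_cons_eq_sgen_mul, map_mul, hg, mul_one]

end Moves

/-! ### The measure -/

section Measure

variable [Fintype ι] {n : ℕ}

/-- The measure of an assignment: total length, then total left-half weight. [cite: LyndonSchupp2001, Ch. I §2] -/
def zMeasure (X : ι → FreeGroup (Fin n)) : Lex (ℕ × ℕ) :=
  toLex (∑ i, (X i).norm, ∑ i, lexWeight (X i))

omit [DecidableEq ι] in
/-- A change of a single value which shortens it, or keeps its length and lowers its left-half
weight, lowers the measure. [folklore] -/
theorem zMeasure_lt_of_single {X X' : ι → FreeGroup (Fin n)} (k : ι) (hfix : ∀ i, i ≠ k → X' i = X i)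
    (h : (X' k).norm < (X k).norm ∨ ((X' k).norm = (X k).norm ∧ lexWeight (X' k) < lexWeight (X k))) :
    zMeasure X' < zMeasure X := by
  rcases h with h | ⟨h₁, h₂⟩
  · apply Prod.Lex.left
    exact Finset.sum_lt_sum (fun j _ => by
      rcases eq_or_ne j k with rfl | hj; exacts [h.le, (congrArg _ (hfix j hj)).le]) ⟨k, Finset.mem_univ _, h⟩
  · have he : ∑ i, (X' i).norm = ∑ i, (X i).norm :=
      Finset.sum_congr rfl fun j _ => by rcases eq_or_ne j k with rfl | hj; exacts [h₁, congrArg _ (hfix j hj)]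
    rw [zMeasure, zMeasure, he]
    apply Prod.Lex.right
    exact Finset.sum_lt_sum (fun j _ => by
      rcases eq_or_ne j k with rfl | hj; exacts [h₂.le, (congrArg _ (hfix j hj)).le]) ⟨k, Finset.mem_univ _, h₂⟩

omit [DecidableEq ι] [Fintype ι] in
/-- Norm and left-half weight of a symbol are those of either of its two letters. [folklore] -/
theorem norm_lexWeight_of_lift_sgen {X : ι → FreeGroup (Fin n)} {k : ι} {s : Bool} {m : FreeGroup (Fin n)}
    (h : FreeGroup.lift X (sgen k s) = m) : (X k).norm = m.norm ∧ lexWeight (X k) = lexWeight m := by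
  cases s
  · rw [sgen_false, map_inv, FreeGroup.lift_apply_of, inv_eq_iff_eq_inv] at h
    rw [h, FreeGroup.norm_inv_eq, lexWeight_inv]; exact ⟨rfl, rfl⟩
  · rw [sgen_true, FreeGroup.lift_apply_of] at h
    rw [h]; exact ⟨rfl, rfl⟩

end Measure

/-! ### The step -/

section Step

variable [Fintype ι] {n : ℕ}

/-- **One step of Zieschang's reduction.**  If `X` kills the quadratic word `w` but `w` does not
die on deleting the symbols with trivial value, then some transport move (with its transvection
`ψ`, `ψ(w')` conjugate to `w`) lowers the measure of the transformed assignment `X̂ ∘ ψ`.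
[cite: ZieschangVogtColdewey1980, Thm. 5.2.6 and proof of Thm. 5.2.8] -/
theorem exists_step (w : List (ι × Bool)) (hq : IsQuadratic w) (X : ι → FreeGroup (Fin n))
    (hX : FreeGroup.lift X (FreeGroup.mk w) = 1)
    (hnt : FreeGroup.mk (w.filter fun x => decide ¬ (X x.1 = 1)) ≠ 1) :
    ∃ (w' : List (ι × Bool)) (ψ : MulAut (FreeGroup ι)) (c : FreeGroup ι),
      w' ~ w ∧ ψ (FreeGroup.mk w') = c * FreeGroup.mk w * c⁻¹ ∧
      zMeasure (fun i => FreeGroup.lift X (ψ (FreeGroup.of i))) < zMeasure X := by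
  set q : ι × Bool → Bool := fun x => decide ¬ (X x.1 = 1) with hqdef
  -- survivors and gaps
  obtain ⟨pre, blocks, hw, hred, hpre, hgap⟩ := exists_reduce_filter_decomp q w
  -- the factor values
  set U : List (FreeGroup (Fin n)) := blocks.map fun b => val X b.1 with hU
  have hval : ∀ x : ι × Bool, FreeGroup.lift X (sgen x.1 x.2) = val X x := fun x => lift_sgen X x
  have hqmem : ∀ b ∈ blocks, q b.1 = true := fun b hb => by
    have : b.1 ∈ FreeGroup.reduce (w.filter q) := by rw [hred]; exact mem_map_of_mem hb
    exact (mem_filter.1 (mem_of_mem_reduce this)).2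
  have hne : ∀ u ∈ U, u ≠ 1 := by
    intro u hu
    obtain ⟨b, hb, rfl⟩ := mem_map.1 hu
    have h1 : X b.1.1 ≠ 1 := by simpa [hqdef] using hqmem b hb
    obtain ⟨⟨i, c⟩, g⟩ := b
    cases c <;> simpa [val] using h1
  have hUne : U ≠ [] := by
    intro hU0
    have hb0 : blocks = [] := by simpa [hU] using hU0
    apply hnt
    rw [← FreeGroup.toWord_eq_nil_iff, FreeGroup.toWord_mk, hred, hb0, map_nil]
  have hprod : U.prod = 1 := by
    rw [← hX, hw, mk_append, map_mul, lift_mk_eq_one_of_filter X hpre, one_mul, lift_mk_flatten_blocks, hU]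
    congr 1
    refine map_congr_left fun b hb => ?_
    rw [hval, lift_mk_eq_one_of_filter X (hgap b hb), mul_one]
  -- the reduced survivor word
  have hredR : FreeGroup.IsReduced (blocks.map Prod.fst) := by
    rw [← hred, FreeGroup.isReduced_iff_reduce_eq, FreeGroup.reduce.idem]
  -- a survivor's partner is a survivor letter, not inside any gap
  have hqpart : ∀ x : ι × Bool, q x = true → q (x.1, !x.2) = true := fun x hx => by
    simpa [hqdef] using hx
  -- the two ways of using a consecutive pair of blocks
  have key : ∀ (Pb Qb : List ((ι × Bool) × List (ι × Bool))) (b₁ b₂ : (ι × Bool) × List (ι × Bool)),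
      blocks = Pb ++ b₁ :: b₂ :: Qb →
      (∃ (w' : List (ι × Bool)) (ψ : MulAut (FreeGroup ι)) (c : FreeGroup ι),
        w' ~ w ∧ ψ (FreeGroup.mk w') = c * FreeGroup.mk w * c⁻¹ ∧
        (∀ i, i ≠ b₁.1.1 → ψ (FreeGroup.of i) = FreeGroup.of i) ∧
        FreeGroup.lift X (ψ (sgen b₁.1.1 b₁.1.2)) = val X b₁.1 * val X b₂.1) ∧
      (∃ (w' : List (ι × Bool)) (ψ : MulAut (FreeGroup ι)) (c : FreeGroup ι),
        w' ~ w ∧ ψ (FreeGroup.mk w') = c * FreeGroup.mk w * c⁻¹ ∧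
        (∀ i, i ≠ b₂.1.1 → ψ (FreeGroup.of i) = FreeGroup.of i) ∧
        FreeGroup.lift X (ψ (sgen b₂.1.1 b₂.1.2)) = val X b₁.1 * val X b₂.1) := by
    intro Pb Qb b₁ b₂ hbl
    obtain ⟨x, g⟩ := b₁
    obtain ⟨y, g'⟩ := b₂
    have hw' : w = (pre ++ (Pb.map fun b => b.1 :: b.2).flatten) ++ x :: (g ++ y :: (g' ++ (Qb.map fun b => b.1 :: b.2).flatten)) := by
      rw [hw, hbl]; simp
    have hx : q x = true := hqmem (x, g) (by rw [hbl]; simp)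
    have hy : q y = true := hqmem (y, g') (by rw [hbl]; simp)
    have hgq : FreeGroup.mk (g.filter q) = 1 := hgap (x, g) (by rw [hbl]; simp)
    have hg1 : FreeGroup.lift X (FreeGroup.mk g) = 1 := lift_mk_eq_one_of_filter X hgq
    -- the partners of `x` and of `y` are not in `g`
    have hxg : (x.1, !x.2) ∉ g :=
      hq.partner_not_mem_of_gap hw' (Or.inr (sublist_append_left g _)) q hx (hqpart x hx) hgq
    have hyg : (y.1, !y.2) ∉ g := by
      have hw'' : w = (pre ++ (Pb.map fun b => b.1 :: b.2).flatten ++ x :: g) ++ y :: (g' ++ (Qb.map fun b => b.1 :: b.2).flatten) := by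
        rw [hw']; simp
      exact hq.partner_not_mem_of_gap hw'' (Or.inl ((sublist_cons_self x g).trans (sublist_append_right _ _)))
        q hy (hqpart y hy) hgq
    -- `x` and `y` are adjacent in a reduced word, so not partners
    have hxy : (x.1, !x.2) ≠ y := by
      intro hxy
      have hr : FreeGroup.IsReduced (x :: y :: Qb.map Prod.fst) := by
        have : blocks.map Prod.fst = Pb.map Prod.fst ++ x :: y :: Qb.map Prod.fst := by rw [hbl]; simp
        rw [this] at hredR
        exact hredR.infix ⟨Pb.map Prod.fst, [], by simp⟩
      have := (FreeGroup.isReduced_cons_cons.1 hr).1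
      rw [← hxy] at this
      have := this rfl
      cases x.2 <;> simp at this
    have hyx : (y.1, !y.2) ≠ x := by
      intro hyx; apply hxy; rw [← hyx]; simp
    constructor
    · obtain ⟨w', ψ, c, h1, h2, h3, h4⟩ := exists_move_absorb_right hq hw' hxg hxy X hg1
      exact ⟨w', ψ, c, h1, h2, h3, by rw [h4, hval, hval]⟩
    · obtain ⟨w', ψ, c, h1, h2, h3, h4⟩ := exists_move_absorb_left hq hw' hyg hyx X hg1
      exact ⟨w', ψ, c, h1, h2, h3, by rw [h4, hval, hval]⟩
  -- how a move changes the measure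
  have measure_of : ∀ (b : (ι × Bool) × List (ι × Bool)) (m : FreeGroup (Fin n)) (ψ : MulAut (FreeGroup ι)),
      (∀ i, i ≠ b.1.1 → ψ (FreeGroup.of i) = FreeGroup.of i) →
      FreeGroup.lift X (ψ (sgen b.1.1 b.1.2)) = m →
      (m.norm < (val X b.1).norm ∨ (m.norm = (val X b.1).norm ∧ lexWeight m < lexWeight (val X b.1))) →
      zMeasure (fun i => FreeGroup.lift X (ψ (FreeGroup.of i))) < zMeasure X := by
    intro b m ψ hfix hm hlt
    set X' : ι → FreeGroup (Fin n) := fun i => FreeGroup.lift X (ψ (FreeGroup.of i)) with hX'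
    have hX'm : FreeGroup.lift X' (sgen b.1.1 b.1.2) = m := by
      have : FreeGroup.lift X' = (FreeGroup.lift X).comp ψ.toMonoidHom :=
        FreeGroup.ext_hom _ _ fun i => by simp [hX']
      rw [this]; exact hm
    obtain ⟨hn, hl⟩ := norm_lexWeight_of_lift_sgen hX'm
    obtain ⟨hn₀, hl₀⟩ := norm_lexWeight_of_lift_sgen (hval b.1)
    refine zMeasure_lt_of_single b.1.1 (fun i hi => by simp [hX', hfix i hi]) ?_
    rw [hn, hl, hn₀, hl₀]
    exact hlt
  -- the violation
  rcases exists_violation_of_prod_eq_one hne hUne hprod with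
    ⟨P, Q, u, v, hPQ, hlt⟩ | ⟨P, Q, u, v, z, hPQ, h₁, h₂⟩
  · -- (N1) fails at consecutive survivors
    rw [hU, map_eq_append_iff] at hPQ
    obtain ⟨Pb, rest, hbl, -, hrest⟩ := hPQ
    rw [map_eq_cons_iff] at hrest
    obtain ⟨b₁, rest', rfl, hu, hrest'⟩ := hrest
    rw [map_eq_cons_iff] at hrest'
    obtain ⟨b₂, Qb, rfl, hv, -⟩ := hrest'
    obtain ⟨hR, hL⟩ := key Pb Qb b₁ b₂ hbl
    have hnorm := norm_mul_eq u v
    rcases hlt with hlt | hlt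
    · -- more than half of `u` cancels: `y` absorbs `x`
      obtain ⟨w', ψ, c, h1, h2, h3, h4⟩ := hL
      refine ⟨w', ψ, c, h1, h2, measure_of b₂ (u * v) ψ h3 (by rw [h4, hu, hv]) (Or.inl ?_)⟩
      rw [hv]; omega
    · -- more than half of `v` cancels: `x` absorbs `y`
      obtain ⟨w', ψ, c, h1, h2, h3, h4⟩ := hR
      refine ⟨w', ψ, c, h1, h2, measure_of b₁ (u * v) ψ h3 (by rw [h4, hu, hv]) (Or.inl ?_)⟩
      rw [hu]; omega
  · -- (N2) fails at consecutive survivors `u, v, z`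
    rw [hU, map_eq_append_iff] at hPQ
    obtain ⟨Pb, rest, hbl, -, hrest⟩ := hPQ
    rw [map_eq_cons_iff] at hrest
    obtain ⟨b₁, rest', rfl, hu, hrest'⟩ := hrest
    rw [map_eq_cons_iff] at hrest'
    obtain ⟨b₂, rest'', rfl, hv, hrest''⟩ := hrest'
    rw [map_eq_cons_iff] at hrest''
    obtain ⟨b₃, Qb, rfl, hz, -⟩ := hrest''
    have hnorm₁ := norm_mul_eq u v
    have hnorm₂ := norm_mul_eq v z
    by_cases hu' : u.norm < 2 * maxCancel u.toWord v.toWord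
    · -- then (N1) already fails at `u, v`: `v` absorbs `u`
      obtain ⟨-, hL⟩ := key Pb (b₃ :: Qb) b₁ b₂ hbl
      obtain ⟨w', ψ, c, h1, h2, h3, h4⟩ := hL
      refine ⟨w', ψ, c, h1, h2, measure_of b₂ (u * v) ψ h3 (by rw [h4, hu, hv]) (Or.inl ?_)⟩
      rw [hv]; omega
    by_cases hz' : z.norm < 2 * maxCancel v.toWord z.toWord
    · -- (N1) fails at `v, z`: `v` absorbs `z`
      obtain ⟨hR, -⟩ := key (Pb ++ [b₁]) Qb b₂ b₃ (by rw [hbl]; simp)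
      obtain ⟨w', ψ, c, h1, h2, h3, h4⟩ := hR
      refine ⟨w', ψ, c, h1, h2, measure_of b₂ (v * z) ψ h3 (by rw [h4, hv, hz]) (Or.inl ?_)⟩
      rw [hv]; omega
    -- genuine (N2) failure: Lyndon–Schupp's dichotomy on the left halves
    have hvne : v ≠ 1 := hne v (by rw [hU, hbl]; simp [hv])
    set κ := maxCancel u.toWord v.toWord with hκ
    have hvlen : v.toWord.length = 2 * κ := by simp only [FreeGroup.norm] at h₁; omega
    have h₂' : maxCancel v.toWord z.toWord = κ := by omega
    rcases norm_mul_eq_and_lexWeight_lt_or u v z κ hvlen hvne rfl h₂'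
      (by simp only [FreeGroup.norm] at hu' ⊢; omega) (by simp only [FreeGroup.norm] at hz' ⊢; omega) with
      ⟨hn, hl⟩ | ⟨hn, hl⟩
    · -- `x` (the letter of `u`) absorbs `y`
      obtain ⟨hR, -⟩ := key Pb (b₃ :: Qb) b₁ b₂ hbl
      obtain ⟨w', ψ, c, h1, h2, h3, h4⟩ := hR
      exact ⟨w', ψ, c, h1, h2, measure_of b₁ (u * v) ψ h3 (by rw [h4, hu, hv])
        (Or.inr ⟨by rw [hu]; exact hn, by rw [hu]; exact hl⟩)⟩
    · -- the letter of `z` absorbs `y`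
      obtain ⟨-, hL⟩ := key (Pb ++ [b₁]) Qb b₂ b₃ (by rw [hbl]; simp)
      obtain ⟨w', ψ, c, h1, h2, h3, h4⟩ := hL
      exact ⟨w', ψ, c, h1, h2, measure_of b₃ (v * z) ψ h3 (by rw [h4, hv, hz])
        (Or.inr ⟨by rw [hz]; exact hn, by rw [hz]; exact hl⟩)⟩

end Step

/-! ### The engine -/

section Engine

variable [Fintype ι] {n : ℕ}

/-- **Zieschang's reduction terminates** (ZVC Thm. 5.2.6 / E 5.4 for value `1`): for a quadratic
word `w₀` and an assignment `X₀` killing it there are a permutation `w` of `w₀` (again quadratic)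
and an automorphism `θ` of `F(ι)` with `θ(w)` conjugate to `w₀`, such that the transformed
assignment `X = X̂₀ ∘ θ` kills `w` ALREADY AFTER DELETING ITS TRIVIAL SYMBOLS: the word obtained
from `w` by deleting the letters `xᵢ^{±1}` with `X i = 1` is trivial in `F(ι)`.
[cite: ZieschangVogtColdewey1980, Thm. 5.2.6, 5.2.8 (proof), E 5.4] [cite: Zieschang1964] -/
theorem exists_terminal (w₀ : List (ι × Bool)) (hq₀ : IsQuadratic w₀) (X₀ : ι → FreeGroup (Fin n))
    (hX₀ : FreeGroup.lift X₀ (FreeGroup.mk w₀) = 1) :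
    ∃ (w : List (ι × Bool)) (θ : MulAut (FreeGroup ι)) (c : FreeGroup ι),
      w ~ w₀ ∧ θ (FreeGroup.mk w) = c * FreeGroup.mk w₀ * c⁻¹ ∧
      FreeGroup.mk (w.filter fun x => decide ¬ (FreeGroup.lift X₀ (θ (FreeGroup.of x.1)) = 1)) = 1 := by
  -- well-founded induction on the measure of the transformed assignment
  suffices H : ∀ (m : Lex (ℕ × ℕ)) (w : List (ι × Bool)) (θ : MulAut (FreeGroup ι)) (c : FreeGroup ι),
      w ~ w₀ → θ (FreeGroup.mk w) = c * FreeGroup.mk w₀ * c⁻¹ →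
      zMeasure (fun i => FreeGroup.lift X₀ (θ (FreeGroup.of i))) = m →
      ∃ (w' : List (ι × Bool)) (θ' : MulAut (FreeGroup ι)) (c' : FreeGroup ι),
        w' ~ w₀ ∧ θ' (FreeGroup.mk w') = c' * FreeGroup.mk w₀ * c'⁻¹ ∧
        FreeGroup.mk (w'.filter fun x => decide ¬ (FreeGroup.lift X₀ (θ' (FreeGroup.of x.1)) = 1)) = 1 from
    H _ w₀ 1 1 (Perm.refl _) (by simp) rfl
  intro m
  refine WellFounded.induction (C := fun m => ∀ (w : List (ι × Bool)) (θ : MulAut (FreeGroup ι)) (c : FreeGroup ι),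
      w ~ w₀ → θ (FreeGroup.mk w) = c * FreeGroup.mk w₀ * c⁻¹ →
      zMeasure (fun i => FreeGroup.lift X₀ (θ (FreeGroup.of i))) = m →
      ∃ (w' : List (ι × Bool)) (θ' : MulAut (FreeGroup ι)) (c' : FreeGroup ι),
        w' ~ w₀ ∧ θ' (FreeGroup.mk w') = c' * FreeGroup.mk w₀ * c'⁻¹ ∧
        FreeGroup.mk (w'.filter fun x => decide ¬ (FreeGroup.lift X₀ (θ' (FreeGroup.of x.1)) = 1)) = 1)
    wellFounded_lt m ?_
  intro m ih w θ c hperm hθ hm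
  · set X : ι → FreeGroup (Fin n) := fun i => FreeGroup.lift X₀ (θ (FreeGroup.of i)) with hXdef
    have hXhom : FreeGroup.lift X = (FreeGroup.lift X₀).comp θ.toMonoidHom :=
      FreeGroup.ext_hom _ _ fun i => by simp [hXdef]
    have hXw : FreeGroup.lift X (FreeGroup.mk w) = 1 := by
      rw [hXhom, MonoidHom.comp_apply, MulEquiv.coe_toMonoidHom, hθ, map_mul, map_mul, hX₀, mul_one,
        map_inv, mul_inv_cancel]
    by_cases hterm : FreeGroup.mk (w.filter fun x => decide ¬ (X x.1 = 1)) = 1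
    · exact ⟨w, θ, c, hperm, hθ, hterm⟩
    · obtain ⟨w', ψ, c₁, hperm', hψ, hlt⟩ := exists_step w (hq₀.perm hperm.symm) X hXw hterm
      have hX' : (fun i => FreeGroup.lift X (ψ (FreeGroup.of i))) =
          fun i => FreeGroup.lift X₀ ((θ * ψ) (FreeGroup.of i)) := by
        funext i
        rw [hXhom, MonoidHom.comp_apply, MulEquiv.coe_toMonoidHom, MulAut.mul_apply]
      rw [hX', hm] at hlt
      exact ih _ hlt w' (θ * ψ) (θ c₁ * c) (hperm'.trans hperm)
        (by rw [MulAut.mul_apply, hψ, map_mul, map_mul, hθ, map_inv]; group) rfl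

end Engine

end Literature.GroupTheory.CombinatorialGroupTheory
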